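import Literature.Probability.LatticeModels.InterfaceSLECylinder
import Literature.Probability.RandomPlanarGeometry.SpinObservableLocalMartingale
import Literature.Probability.RandomPlanarGeometry.DrivingFunctionMeasurable
import HarnessLib

/-!
# Critical Ising interfaces and SLE₃: F2 from the cylinder identity WITHOUT moment bounds

Topic `Literature/Probability/LatticeModels` (family `crit-ising`). Eighth file of the
decomposition of **crit-ising.S17, spin half** — Chelkak–Duminil-Copin–Hongler–Kemppainen–
Smirnov, *Convergence of Ising interfaces to Schramm's SLE curves*, C. R. Math. Acad. Sci.
Paris 352 (2014) 157–161 (arXiv:1312.0533), Theorem 1; corrected transcription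
`convergesInLawToSLE_three_isingInterface_zd` (`InterfaceSLEProofs.lean`), identification half
F2 = `isSLELaw_three_of_subseqLimit_spinInterface` (CDHKS §3).

`InterfaceSLECylinder.lean` reduced F2 (through the named fact (M)
`exists_drivingMartingales_of_subseqLimit_spinInterface`) to a cylinder-identity statement for a
regular version `W` of the driving process of every subsequential limit, one of whose clauses is
the **moment bound** "the running supremum of `|W|` on each `[0, t]` is a.s. dominated by some
`M ∈ L³`" — CDHKS Thm. 3's "`sup_{δ>0} E[exp(ε|W_t^δ|/√t)] < ∞`" (Kemppainen–Smirnov 2017,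
Prop. 3.8), used in CDHKS §3 to "exchange the asymptotic expansion with the conditional
expectation". Here that clause is REMOVED: by
`Loewner.isLocalMartingale_hasQuadraticVariation_of_spinCylinderIdentity`
(`RandomPlanarGeometry/SpinObservableLocalMartingale.lean`: localise at the far-field stopping
time of a fixed level and let the level of the observable tend to `∞`; the coefficient
martingales are then exact on the stopped processes, so `W/√3` is a continuous LOCAL martingale
with quadratic variation `t`, which is all that Lévy's characterisation needs) and the
unconditional criterion `isSLELaw_of_isLocalMartingale_driving_of_lt_four`
(`SLELawOfDrivingProcessLocal.lean`), every subsequential limit is the chordal SLE₃ law as soon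
as the cylinder identity holds for a regular version of its driving process — strongly
measurable coordinates, continuous paths, `W_0 = 0`, a.e. Loewner-describing the curve — with
no integrability hypothesis on `W` whatsoever.

Results (PROVED; no definition, no named fact):

* `isSLELaw_three_of_subseqLimit_spinInterface_of_cylinderIdentity_local` — F2 from the
  moment-free cylinder-identity statement;
* `convergesInLawToSLE_three_isingInterface_zd_of_traversalBound_of_cylinderIdentity_local` —
  hence the corrected CDHKS Theorem 1 from the traversal bound (C1)
  `spinInterface_traversalBound` and that statement;
* `isSLELaw_three_of_subseqLimit_spinInterface_of_drivingFunction_cylinderIdentity` — the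
  CANONICAL form: no version `W` is quantified; the hypothesis is that `ν`-a.e. curve class is
  describable by the Loewner evolution through `φ` (Kemppainen–Smirnov 2017, Thm. 1.5 (ii), as
  printed), that `ν` is carried by curves from `a`, and that the cylinder identity holds for the
  Loewner transform `drivingFunction φ` itself (a Borel function of the curve,
  `DrivingFunctionMeasurable.lean`);
(The hypothesis of `InterfaceSLECylinder.lean`, with the `L³` clause, trivially implies the
moment-free hypothesis used here — drop the clause — so nothing is lost.)

Consequently the lattice inputs still packaged below F2 are: (J′) the convergence in law of the
capacity driving processes of the discrete interfaces along the subsequence to a version `W` of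
the driving process of the limit, `ν`-a.e. Loewner-describing it (Kemppainen–Smirnov 2017,
Thm. 1.5 and Cor. 1.7, from CDHKS Thm. 4/Rem. 4 = (C1)) — WITHOUT the exponential-moment
statement of CDHKS Thm. 3 — and (D) the discrete fermionic observable martingale with its
convergence uniformly over slit domains (Chelkak–Smirnov 2012, Thms 1.2, 5.6, Rem. 2.4), glued
by the PROVED `Loewner.integral_spinObservableProcess_cylinder_eq_zero_of_discreteMartingales`
(`SpinObservableLimitPassage.lean`), whose hypotheses never involved moments.

## References

* D. Chelkak, H. Duminil-Copin, C. Hongler, A. Kemppainen, S. Smirnov, *Convergence of Ising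
  interfaces to Schramm's SLE curves*, C. R. Math. Acad. Sci. Paris 352 (2014) 157–161
  (arXiv:1312.0533): Thm. 1, Thm. 3, §3 (p. 7 of the arXiv version).
* A. Kemppainen, S. Smirnov, *Random curves, scaling limits and Loewner evolutions*, Ann. Probab.
  45 (2017) 698–779, Thm. 1.5, Cor. 1.7, Prop. 3.8.
* D. Revuz, M. Yor, *Continuous Martingales and Brownian Motion* (1999), Ch. IV, Thm. (3.6).
-/

noncomputable section

open MeasureTheory Filter Topology
open UpperHalfPlane (upperHalfPlaneSet)
open scoped NNReal BoundedContinuousFunction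
open Literature.Probability.LatticeModels Literature.Probability.Percolation
open Literature.Probability.RandomPlanarGeometry (CurveClass DobrushinDomain ConformalEquiv)
open Literature.Probability.RandomPlanarGeometry.Loewner (spinObservableProcess)

namespace Literature.Probability.LatticeModels

/-! ### F2 from the moment-free cylinder identity -/

/-- **F2 from CDHKS's observable martingale in cylinder form, without moment bounds.** Suppose
that for every Dobrushin domain `(D; a, b)`, admissible discretisations `E`, interface-selection
rules `sel`, meshes `u n → 0⁺` and every probability measure `ν` on the curve space to which the
critical spin-Ising interface laws `spinInterfaceLaw D E sel (u n)` converge weakly, there are a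
chordal uniformizing map `φ : ℍ → D` and a process `W : CurveClass ℂ → ([0, ∞) → ℝ)` with
strongly measurable coordinates, continuous paths and `W_0 = 0`, `ν`-a.e. Loewner-describing
the curve through `φ` (`IsLoewnerDescribed`; CDHKS Thm. 3 = Kemppainen–Smirnov 2017, Thm. 1.5,
Cor. 1.7, WITHOUT the exponential-moment clause — NO integrability assumption on `W`), such that
for every `y > 0` the time-limited spin observable `N^y = Loewner.spinObservableProcess W y`
satisfies `∫ (N^y_t - N^y_s) ψ(W_{S_0}, …, W_{S_{n-1}}) dν = 0` for all `s ≤ t`, `S ≤ s`,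
continuous `|ψ| ≤ 1` (CDHKS §3: "`M_t(z)`, `t ≤ T(z)`, … is a martingale with respect to the
filtration generated by `W_t`", in monotone-class form). Then every subsequential weak limit of
the critical spin-Ising interface laws is the chordal SLE₃ law of `(D; a, b)`
(`isSLELaw_three_of_subseqLimit_spinInterface`). Proof: the cylinder identity makes `W/√3` a
continuous local martingale with quadratic variation `t` in the natural filtration of `W`
(`Loewner.isLocalMartingale_hasQuadraticVariation_of_spinCylinderIdentity`: monotone class,
optional stopping at the far-field stopping time of a fixed level, far-field expansion (5) with
exact coefficient martingales on the stopped processes, localisation), and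
`isSLELaw_of_isLocalMartingale_driving_of_lt_four` (Lévy's characterisation, existence and
transience of the SLE₃ trace — theorems of the tree) identifies `ν`. This is CDHKS §3's proof of
Thm. 1 with its appeal to the exponential moments of Thm. 3 replaced by localisation. PROVED.
[cite: CDHKSCRAS2014, §3 (proof of Thm. 1)] -/
theorem isSLELaw_three_of_subseqLimit_spinInterface_of_cylinderIdentity_local
    (h : ∀ (D : DobrushinDomain) (E : ℝ → DiscreteDobrushin) (_hE : IsDiscretisation D E)
      (sel : ℝ → SpinConfig (Site 2) → List (Sym2 (Site 2)))
      (_hsel : ∀ δ, IsInterfaceSelection (E δ) (sel δ))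
      (u : ℕ → ℝ) (_hu : Tendsto u atTop (𝓝[>] 0))
      (ν : Measure (CurveClass ℂ)) [IsProbabilityMeasure ν],
      (∀ f : CurveClass ℂ →ᵇ ℝ,
        Tendsto (fun n => ∫ c, f c ∂spinInterfaceLaw D E sel (u n)) atTop (𝓝 (∫ c, f c ∂ν))) →
      ∃ (φ : ConformalEquiv upperHalfPlaneSet D.carrier) (W : CurveClass ℂ → ℝ≥0 → ℝ),
        D.IsChordalUniformizing φ ∧
        (∀ t, StronglyMeasurable (fun c ↦ W c t)) ∧ (∀ c, Continuous (W c)) ∧ (∀ c, W c 0 = 0) ∧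
        (∀ᵐ c ∂ν, RandomPlanarGeometry.IsLoewnerDescribed φ c (W c)) ∧
        ∀ y : ℝ, 0 < y → ∀ s t : ℝ≥0, s ≤ t → ∀ (n : ℕ) (S : Fin n → ℝ≥0), (∀ k, S k ≤ s) →
          ∀ ψ : (Fin n → ℝ) → ℝ, Continuous ψ → (∀ v, |ψ v| ≤ 1) →
            ∫ c, (spinObservableProcess (fun t c ↦ W c t) y t c -
                spinObservableProcess (fun t c ↦ W c t) y s c) *
              (ψ (fun k ↦ W c (S k)) : ℂ) ∂ν = 0) :
    isSLELaw_three_of_subseqLimit_spinInterface := by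
  intro D E hE sel hsel u hu ν hν hlim
  obtain ⟨φ, W, hφ, hW, hWc, hW0, hdesc, hcyl⟩ := h D E hE sel hsel u hu ν hlim
  obtain ⟨hloc, hQ⟩ :=
    RandomPlanarGeometry.Loewner.isLocalMartingale_hasQuadraticVariation_of_spinCylinderIdentity
      (W := fun t c ↦ W c t) (P := ν) hW hWc hW0 hcyl
  have hsq : Real.sqrt ((3 : ℝ≥0) : ℝ) = Real.sqrt 3 := by norm_num
  refine RandomPlanarGeometry.isSLELaw_of_isLocalMartingale_driving_of_lt_four zero_lt_three
    (by norm_num) hφ (fun t ↦ (hW t).measurable) (ae_of_all _ hW0) (ae_of_all _ hWc)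
    (𝓕 := Filtration.natural (fun t c ↦ W c t) hW) ?_ ?_ ?_
  · simpa only [hsq] using hloc
  · simpa only [hsq] using hQ
  · filter_upwards [hdesc] with c hc
    obtain ⟨-, γ, hγ, c', hc', hI⟩ := hc
    exact ⟨γ, hγ, c', hc', hI⟩

/-- **CDHKS Theorem 1 (corrected transcription) from (C1) and the moment-free cylinder
identity.** Convergence in law of the critical spin-Ising Dobrushin interfaces to chordal SLE₃,
`convergesInLawToSLE_three_isingInterface_zd`, follows from the traversal bound (C1)
`spinInterface_traversalBound` (CDHKS §2) and the moment-free cylinder-identity hypothesis of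
`isSLELaw_three_of_subseqLimit_spinInterface_of_cylinderIdentity_local` (CDHKS Thm. 3 without
its moment clause, and §3 before its last paragraph); tightness, Prokhorov, uniqueness in law of
chordal SLE, Lévy, the Rohde–Schramm theorems at `κ = 3` and the moment-free passage observable
martingale ⟹ driving local martingales are theorems of the tree. PROVED.
[cite: CDHKSCRAS2014, Thm. 1, §§2–3] -/
theorem convergesInLawToSLE_three_isingInterface_zd_of_traversalBound_of_cylinderIdentity_local
    (h1 : spinInterface_traversalBound)
    (h : ∀ (D : DobrushinDomain) (E : ℝ → DiscreteDobrushin) (_hE : IsDiscretisation D E)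
      (sel : ℝ → SpinConfig (Site 2) → List (Sym2 (Site 2)))
      (_hsel : ∀ δ, IsInterfaceSelection (E δ) (sel δ))
      (u : ℕ → ℝ) (_hu : Tendsto u atTop (𝓝[>] 0))
      (ν : Measure (CurveClass ℂ)) [IsProbabilityMeasure ν],
      (∀ f : CurveClass ℂ →ᵇ ℝ,
        Tendsto (fun n => ∫ c, f c ∂spinInterfaceLaw D E sel (u n)) atTop (𝓝 (∫ c, f c ∂ν))) →
      ∃ (φ : ConformalEquiv upperHalfPlaneSet D.carrier) (W : CurveClass ℂ → ℝ≥0 → ℝ),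
        D.IsChordalUniformizing φ ∧
        (∀ t, StronglyMeasurable (fun c ↦ W c t)) ∧ (∀ c, Continuous (W c)) ∧ (∀ c, W c 0 = 0) ∧
        (∀ᵐ c ∂ν, RandomPlanarGeometry.IsLoewnerDescribed φ c (W c)) ∧
        ∀ y : ℝ, 0 < y → ∀ s t : ℝ≥0, s ≤ t → ∀ (n : ℕ) (S : Fin n → ℝ≥0), (∀ k, S k ≤ s) →
          ∀ ψ : (Fin n → ℝ) → ℝ, Continuous ψ → (∀ v, |ψ v| ≤ 1) →
            ∫ c, (spinObservableProcess (fun t c ↦ W c t) y t c -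
                spinObservableProcess (fun t c ↦ W c t) y s c) *
              (ψ (fun k ↦ W c (S k)) : ℂ) ∂ν = 0) :
    convergesInLawToSLE_three_isingInterface_zd :=
  convergesInLawToSLE_three_isingInterface_zd_of_traversalBound' h1
    (isSLELaw_three_of_subseqLimit_spinInterface_of_cylinderIdentity_local h)

/-! ### Canonical form: the Loewner transform `drivingFunction φ` as the version -/

/-- **F2 from describability and the cylinder identity for the Loewner transform.** Suppose that
for every Dobrushin domain `(D; a, b)`, admissible discretisations, selection rules, meshes
`u n → 0⁺` and every probability measure `ν` on the curve space to which the critical spin-Ising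
interface laws converge weakly, there is a chordal uniformizing map `φ : ℍ → D` such that:
`ν`-a.e. curve class is describable by the Loewner evolution through `φ`
(`IsLoewnerDescribable`; Kemppainen–Smirnov 2017, Thm. 1.5 (ii) / CDHKS Thm. 3: "a.s., the curve
… can be fully described by the Loewner evolution"), `ν`-a.e. curve class starts at `a`
(the interfaces start at `a^δ → a`), and for every `y > 0` the time-limited spin observable of
the Loewner transform `W = drivingFunction φ` (`LoewnerDescription.lean`; a Borel function of the
curve, `measurable_drivingFunction`) satisfies the cylinder identity
`∫ (N^y_t - N^y_s) ψ(W_{S_0}, …, W_{S_{n-1}}) dν = 0` (`s ≤ t`, `S ≤ s`, continuous `|ψ| ≤ 1`).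
Then F2 `isSLELaw_three_of_subseqLimit_spinInterface` holds. PROVED from
`isSLELaw_three_of_subseqLimit_spinInterface_of_cylinderIdentity_local` with the version
`W' c = W c - W c 0` (`= W c` for `ν`-a.e. `c`, by `ae_drivingFunction_apply_zero`; strongly
measurable marginals by `stronglyMeasurable_drivingFunction_apply`, continuous paths by
`continuous_drivingFunction`, `W' c 0 = 0` for every `c`). No moment hypothesis, no version to
choose. [cite: CDHKSCRAS2014, Thm. 3 and §3 (proof of Thm. 1)]
[cite: KemppainenSmirnov2017, Thm. 1.5 and Cor. 1.7] -/
theorem isSLELaw_three_of_subseqLimit_spinInterface_of_drivingFunction_cylinderIdentity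
    (h : ∀ (D : DobrushinDomain) (E : ℝ → DiscreteDobrushin) (_hE : IsDiscretisation D E)
      (sel : ℝ → SpinConfig (Site 2) → List (Sym2 (Site 2)))
      (_hsel : ∀ δ, IsInterfaceSelection (E δ) (sel δ))
      (u : ℕ → ℝ) (_hu : Tendsto u atTop (𝓝[>] 0))
      (ν : Measure (CurveClass ℂ)) [IsProbabilityMeasure ν],
      (∀ f : CurveClass ℂ →ᵇ ℝ,
        Tendsto (fun n => ∫ c, f c ∂spinInterfaceLaw D E sel (u n)) atTop (𝓝 (∫ c, f c ∂ν))) →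
      ∃ φ : ConformalEquiv upperHalfPlaneSet D.carrier,
        D.IsChordalUniformizing φ ∧
        (∀ᵐ c ∂ν, RandomPlanarGeometry.IsLoewnerDescribable φ c) ∧
        (∀ᵐ c ∂ν, c.source = D.pt 0) ∧
        ∀ y : ℝ, 0 < y → ∀ s t : ℝ≥0, s ≤ t → ∀ (n : ℕ) (S : Fin n → ℝ≥0), (∀ k, S k ≤ s) →
          ∀ ψ : (Fin n → ℝ) → ℝ, Continuous ψ → (∀ v, |ψ v| ≤ 1) →
            ∫ c, (spinObservableProcess (fun t c ↦ RandomPlanarGeometry.drivingFunction φ c t) y t c -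
                spinObservableProcess (fun t c ↦ RandomPlanarGeometry.drivingFunction φ c t) y s c) *
              (ψ (fun k ↦ RandomPlanarGeometry.drivingFunction φ c (S k)) : ℂ) ∂ν = 0) :
    isSLELaw_three_of_subseqLimit_spinInterface := by
  refine isSLELaw_three_of_subseqLimit_spinInterface_of_cylinderIdentity_local
    fun D E hE sel hsel u hu ν hν hlim ↦ ?_
  obtain ⟨φ, hφ, hdesc, h0, hcyl⟩ := h D E hE sel hsel u hu ν hlim
  -- the version `W' c = W c - W c 0`
  set W : CurveClass ℂ → ℝ≥0 → ℝ := RandomPlanarGeometry.drivingFunction φ with hW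
  set W' : CurveClass ℂ → ℝ≥0 → ℝ := fun c t ↦ W c t - W c 0 with hW'
  have hae0 : ∀ᵐ c ∂ν, W c 0 = 0 := RandomPlanarGeometry.ae_drivingFunction_apply_zero hφ h0
  have haeW : ∀ᵐ c ∂ν, W' c = W c := by
    filter_upwards [hae0] with c hc
    funext t
    simp [hW', hc]
  refine ⟨φ, W', hφ, fun t ↦ ?_, fun c ↦ ?_, fun c ↦ ?_, ?_, ?_⟩
  · exact (RandomPlanarGeometry.stronglyMeasurable_drivingFunction_apply hφ t).sub
      (RandomPlanarGeometry.stronglyMeasurable_drivingFunction_apply hφ 0)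
  · exact (RandomPlanarGeometry.continuous_drivingFunction φ c).sub continuous_const
  · simp [hW']
  · filter_upwards [hdesc, haeW] with c hc hcW
    rw [hcW]
    exact RandomPlanarGeometry.isLoewnerDescribed_drivingFunction hc
  · intro y hy s t hst n S hS ψ hψc hψ1
    rw [← hcyl y hy s t hst n S hS ψ hψc hψ1]
    refine integral_congr_ae ?_
    filter_upwards [haeW] with c hcW
    -- the observable and the test function only see the path `W' c = W c`
    have hpath : (fun u ↦ W' c u) = fun u ↦ W c u := funext fun u ↦ congrFun hcW u
    simp only [RandomPlanarGeometry.Loewner.spinObservableProcess_apply, hpath]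

end Literature.Probability.LatticeModels
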